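import Summits.Ventures.DiscreteObjects.Hadamard.Order49FixedTen668
import Summits.Ventures.DiscreteObjects.Hadamard.CompositeOrderTable

/-!
# Hadamard 668 census, family F12 — NO signed automorphism of an H(668) has an element of order 49 in its
# permutation pair: `7² ∤ orderOf (π, κ)` (kernel, exclusion)

Framing: lottery ticket; floor = certified bounds/negative ranges.

Cell pub-namedobj (venture DiscreteObjects), target (H), hadamard gen 18.  Gen 17 (`Order49Structure668`,
`Order49FixedTen668`) left a hypothetical signed automorphism `(π, κ, d, e)` of an H(668) of pair-order `49` with
EXACTLY `10` fixed rows and `10` fixed columns (and `80 / 80` for the 7th powers), remarking that the summed orbit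
identities do not exclude it.  The per-pair identity does.  NEW TOOL (the 'fixed Gram matrix'):
* `four_dvd_card_of_three_orth`: three pairwise-orthogonal `±1` vectors on a finite set `S` force `4 ∣ |S|`
  [`Σ (u+v)(u+w) = Σ u² = |S|` while every term `(u+v)(u+w)` lies in `{0, ±4}`] — the classical reason why Hadamard
  matrices have order `1, 2` or a multiple of `4`.
* **`no_hadamard668_signedAut_order49`**: `π^49 = κ^49 = 1` with `(π⁷, κ⁷) ≠ (1, 1)` is impossible.  PROOF.  By
  `hadamard668_order49_fixed_ten`, `#Fix(π) = #Fix(κ) = 10`.  All `π`-fixed rows carry the sign of a `κ`-fixed column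
  (`signedAut_fixed_sign`), so for two distinct `π`-fixed rows `x ≠ x'` the (E3) lemma `fixedRows_inner_dvd` gives
  `7 ∣ S(x,x') := Σ_{κ y = y} H x y · H x' y`, a sum of ten `±1`'s: even and `|S| ≤ 10`, hence `S = 0`.  Three distinct
  `π`-fixed rows restricted to the ten `κ`-fixed columns are therefore pairwise orthogonal `±1` vectors of length `10`,
  and `4 ∣ 10` is false.  (Equivalently: the `10 × 10` fixed submatrix would be a Hadamard matrix of order `10`.)
* `hadamard668_signedAut_not_dvd_orderOf_49`: **`49 ∤ orderOf (π, κ)`** for every signed automorphism of an H(668)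
  (power trick `exists_pow_of_dvd_orderOf`); `hadamard668_signedAut_pow7_eq_one`: `π^(7^k) = κ^(7^k) = 1 ⇒
  π⁷ = κ⁷ = 1`.  This supersedes `hadamard668_signedAut_not_dvd_orderOf_343` (gen 17).
WORDS.  Kernel: no element of order `49` in the permutation-pair group of signed automorphisms of any H(668), and no
`C₇ × C₇` (gen 17, `no_hadamard668_elemAbelian_rank2_7`).  On paper (one line of group theory: a `7`-group of signed
automorphisms maps injectively to its row permutations by `SignedAutDictionary`, has exponent `7` by this file and no
`C₇ × C₇`, hence order `≤ 7`): **the `7`-part of the order of the signed automorphism group of any H(668) is at most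
`7`.**  Structure of a hypothetical object only: H(668) itself is untouched; no existence claimed.  Ours, not
literature; no `sorry`, default heartbeats.
-/

namespace Summit.Ventures.DiscreteObjects.Hadamard

open Finset BigOperators Matrix

open Literature.Combinatorics.Designs.GoethalsSeidel (IsHadamardMatrix)

variable {ι : Type*} [Fintype ι] [DecidableEq ι]

omit [Fintype ι] [DecidableEq ι] in
/-- **Three pairwise-orthogonal `±1` vectors live in length `≡ 0 (mod 4)`.**  If `u, v, w` take values `±1` on a finite
set `S` and are pairwise orthogonal there, then `4 ∣ |S|`: indeed `Σ_S (u+v)(u+w) = Σ_S u² = |S|` and each term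
`(u+v)(u+w)` is `0` or `±4`. -/
theorem four_dvd_card_of_three_orth (S : Finset ι) (u v w : ι → ℤ)
    (hu : ∀ y ∈ S, u y = 1 ∨ u y = -1) (hv : ∀ y ∈ S, v y = 1 ∨ v y = -1) (hw : ∀ y ∈ S, w y = 1 ∨ w y = -1)
    (huv : ∑ y ∈ S, u y * v y = 0) (huw : ∑ y ∈ S, u y * w y = 0) (hvw : ∑ y ∈ S, v y * w y = 0) :
    (4 : ℤ) ∣ S.card := by
  have hsum : ∑ y ∈ S, (u y + v y) * (u y + w y) = S.card := by
    have h1 : ∀ y ∈ S, (u y + v y) * (u y + w y) = 1 + u y * w y + u y * v y + v y * w y := by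
      intro y hy
      rw [show (u y + v y) * (u y + w y) = u y * u y + u y * w y + u y * v y + v y * w y by ring,
        pm_mul_self (hu y hy)]
    rw [Finset.sum_congr rfl h1, Finset.sum_add_distrib, Finset.sum_add_distrib, Finset.sum_add_distrib,
      Finset.sum_const, huv, huw, hvw]
    simp
  have hdvd : ∀ y ∈ S, (4 : ℤ) ∣ (u y + v y) * (u y + w y) := by
    intro y hy
    rcases hu y hy with h1 | h1 <;> rcases hv y hy with h2 | h2 <;> rcases hw y hy with h3 | h3 <;>
      (rw [h1, h2, h3]; norm_num)
  rw [← hsum]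
  exact Finset.dvd_sum hdvd

section main
variable {H : Matrix ι ι ℤ}

/-- **No signed automorphism of pair-order 49.**  For a Hadamard matrix of order `668` and a signed automorphism
`(π, κ, d, e)` with `π^49 = κ^49 = 1`, the pair `(π⁷, κ⁷)` is trivial.  [Ten fixed rows and columns by
`hadamard668_order49_fixed_ten`; distinct fixed rows are orthogonal on the fixed columns by (E3) mod `7`
(`fixedRows_inner_dvd`: a multiple of `7` which is an even number in `[-10, 10]`); three of them contradict
`four_dvd_card_of_three_orth` since `4 ∤ 10`.] -/
theorem no_hadamard668_signedAut_order49 (hH : IsHadamardMatrix H) (hι : Fintype.card ι = 668)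
    (π κ : Equiv.Perm ι) (d e : ι → ℤ) (haut : IsSignedAut H π κ d e)
    (hπ : π ^ 49 = 1) (hκ : κ ^ 49 = 1) (hne : π ^ 7 ≠ 1 ∨ κ ^ 7 ≠ 1) : False := by
  obtain ⟨-, -, hR, hC⟩ := hadamard668_order49_fixed_ten hH hι π κ d e haut hπ hκ hne
  -- three distinct π-fixed rows
  have h2 : 2 < (univ.filter fun i => π i = i).card := by omega
  obtain ⟨x₁, hx₁, x₂, hx₂, x₃, hx₃, h12, h13, h23⟩ := Finset.two_lt_card.mp h2
  simp only [Finset.mem_filter, Finset.mem_univ, true_and] at hx₁ hx₂ hx₃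
  -- a κ-fixed column pins the signs of all π-fixed rows
  have h0 : 0 < (univ.filter fun j => κ j = j).card := by omega
  obtain ⟨j₀, hj₀⟩ := Finset.card_pos.mp h0
  simp only [Finset.mem_filter, Finset.mem_univ, true_and] at hj₀
  have hd : ∀ x, π x = x → d x = e j₀ := fun x hx => signedAut_fixed_sign hH.1 haut hx hj₀
  -- (E3) mod 7 on ten columns: distinct fixed rows are orthogonal on the fixed columns
  have hS : ∀ x x', x ≠ x' → π x = x → π x' = x' →
      ∑ y ∈ univ.filter (fun j => κ j = j), H x y * H x' y = 0 := by
    intro x x' hxx' hx hx'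
    have hdd : d x = d x' := by rw [hd x hx, hd x' hx']
    have hκ' : κ ^ (7 * 7) = 1 := hκ
    have hdvd := fixedRows_inner_dvd hH haut (by norm_num : (7 : ℕ).Prime) hκ' hxx' hx hx' hdd
    obtain ⟨m, hm, hsum⟩ := sum_pm_eq_card_sub_two_mul (univ.filter fun j => κ j = j) (fun y => H x y * H x' y)
      (fun y _ => by
        rcases hH.1 x y with h1 | h1 <;> rcases hH.1 x' y with h2 | h2 <;> simp [h1, h2])
    rw [hsum] at hdvd ⊢
    rw [hC] at hm hdvd ⊢
    obtain ⟨c, hc⟩ := hdvd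
    push_cast at hc ⊢
    omega
  have hpm : ∀ x, ∀ y ∈ univ.filter (fun j => κ j = j), H x y = 1 ∨ H x y = -1 := fun x y _ => hH.1 x y
  have h4 := four_dvd_card_of_three_orth (univ.filter fun j => κ j = j) (H x₁) (H x₂) (H x₃)
    (hpm x₁) (hpm x₂) (hpm x₃) (hS x₁ x₂ h12 hx₁ hx₂) (hS x₁ x₃ h13 hx₁ hx₃) (hS x₂ x₃ h23 hx₂ hx₃)
  rw [hC] at h4
  obtain ⟨c, hc⟩ := h4
  push_cast at hc
  omega

/-- **`49 ∤ orderOf (π, κ)`** for every signed automorphism `(π, κ, d, e)` of a Hadamard matrix of order `668`. -/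
theorem hadamard668_signedAut_not_dvd_orderOf_49 (hH : IsHadamardMatrix H) (hι : Fintype.card ι = 668)
    (π κ : Equiv.Perm ι) (d e : ι → ℤ) (haut : IsSignedAut H π κ d e)
    (hdvd : 7 * 7 ∣ orderOf ((π, κ) : Equiv.Perm ι × Equiv.Perm ι)) : False := by
  obtain ⟨π', κ', d', e', haut', h1, h2, h3, -⟩ :=
    exists_pow_of_dvd_orderOf haut (by norm_num : (7 : ℕ).Prime) (by norm_num : (7 : ℕ).Prime) hdvd
  exact no_hadamard668_signedAut_order49 hH hι π' κ' d' e' haut' h1 h2 h3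

/-- **Exponent form.**  A signed automorphism of an H(668) whose permutation parts have order a power of `7` has
`π⁷ = κ⁷ = 1`. -/
theorem hadamard668_signedAut_pow7_eq_one (hH : IsHadamardMatrix H) (hι : Fintype.card ι = 668)
    (π κ : Equiv.Perm ι) (d e : ι → ℤ) (haut : IsSignedAut H π κ d e) {k : ℕ}
    (hπ : π ^ 7 ^ k = 1) (hκ : κ ^ 7 ^ k = 1) : π ^ 7 = 1 ∧ κ ^ 7 = 1 := by
  set x : Equiv.Perm ι × Equiv.Perm ι := (π, κ) with hx
  have hxk : x ^ 7 ^ k = 1 := by rw [hx, Prod.pow_mk, hπ, hκ]; rfl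
  have hord : orderOf x ∣ 7 ^ k := orderOf_dvd_of_pow_eq_one hxk
  obtain ⟨i, hi, horder⟩ := (Nat.dvd_prime_pow (by norm_num : (7 : ℕ).Prime)).1 hord
  have hi1 : i ≤ 1 := by
    by_contra hi2
    have h49 : 7 * 7 ∣ orderOf x := by
      rw [horder, show (7 : ℕ) * 7 = 7 ^ 2 by norm_num]
      exact pow_dvd_pow 7 (by omega)
    exact hadamard668_signedAut_not_dvd_orderOf_49 hH hι π κ d e haut h49
  have h7 : x ^ 7 = 1 := by
    have hdvd7 : orderOf x ∣ 7 := by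
      rw [horder]
      interval_cases i
      · simp
      · simp
    exact orderOf_dvd_iff_pow_eq_one.mp hdvd7
  rw [hx, Prod.pow_mk, Prod.mk_eq_one] at h7
  exact h7

end main

end Summit.Ventures.DiscreteObjects.Hadamard
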